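import Literature.Analysis.UnboundedOperators.StrongContRepresentation
import Mathlib.Analysis.SpecialFunctions.Exp
import HarnessLib

/-!
# Conjugating a strongly continuous representation / C₀-semigroup by a topological linear
  isomorphism (similar semigroups; Engel–Nagel I.5.b / II.2.1)

Analysis/UnboundedOperators support file (one definition with body, everything proved, no named
facts). Engel–Nagel (2000), Ch. II §2.1 ("similar semigroups"): if `(T(t))` is a strongly
continuous semigroup on `E` and `e : E → E'` a topological isomorphism, then
`S(t) := e T(t) e⁻¹` is a strongly continuous semigroup on `E'` (with generator `e A e⁻¹`,
`D = e D(A)`). We record the construction for strongly continuous representations of an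
arbitrary topological monoid (`StrongContRepresentation.conj`) and, for C₀-semigroups on
normed spaces and an isometric `e`, the transfer of operator-norm bounds
(`C0Semigroup.norm_conj_app_le`). Used to pass the similarity heat semigroup from the Fourier
side (`Literature.Analysis.OperatorTheory.fourierSimilarityHeatSemigroup`) to physical space
through Mathlib's `L²` Fourier isometry `MeasureTheory.Lp.fourierTransformₗᵢ`.

## References

* K.-J. Engel, R. Nagel, *One-Parameter Semigroups for Linear Evolution Equations* (2000),
  Ch. I §5.b and Ch. II §2.1 (similar / isomorphic semigroups). [EngelNagel2000]
-/

noncomputable section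

open Filter Topology
open scoped NNReal

namespace Literature.Analysis.UnboundedOperators

namespace StrongContRepresentation

variable {𝕜 G V W : Type*} [Ring 𝕜] [Monoid G] [TopologicalSpace G]
  [AddCommGroup V] [TopologicalSpace V] [IsTopologicalAddGroup V] [Module 𝕜 V]
  [AddCommGroup W] [TopologicalSpace W] [IsTopologicalAddGroup W] [Module 𝕜 W]

/-- **Conjugation by a topological linear isomorphism**: `(π.conj e) g = e ∘ π g ∘ e⁻¹`
("similar semigroups"). [cite: EngelNagel2000, Ch. II §2.1] -/
def conj (π : StrongContRepresentation 𝕜 G V) (e : V ≃L[𝕜] W) : StrongContRepresentation 𝕜 G W where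
  toMonoidHom :=
    { toFun := fun g => (e : V →L[𝕜] W).comp ((π g).comp (e.symm : W →L[𝕜] V))
      map_one' := by
        ext w
        simp
      map_mul' := fun g h => by
        ext w
        simp [map_mul] }
  strongly_continuous w := e.continuous.comp (π.continuous_apply_apply (e.symm w))

/-- `(π.conj e) g w = e (π g (e⁻¹ w))`. [cite: EngelNagel2000, Ch. II §2.1] -/
@[simp]
theorem conj_apply_apply (π : StrongContRepresentation 𝕜 G V) (e : V ≃L[𝕜] W) (g : G) (w : W) :
    π.conj e g w = e (π g (e.symm w)) := rfl

/-- `(π.conj e) g = e ∘L π g ∘L e⁻¹`. [cite: EngelNagel2000, Ch. II §2.1] -/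
theorem conj_apply (π : StrongContRepresentation 𝕜 G V) (e : V ≃L[𝕜] W) (g : G) :
    π.conj e g = (e : V →L[𝕜] W).comp ((π g).comp (e.symm : W →L[𝕜] V)) := rfl

end StrongContRepresentation

namespace C0Semigroup

variable {𝕜 E E' : Type*} [RCLike 𝕜] [NormedAddCommGroup E] [NormedSpace 𝕜 E]
  [NormedAddCommGroup E'] [NormedSpace 𝕜 E']

/-- `(T.conj e)(t) = e ∘L T(t) ∘L e⁻¹` for a C₀-semigroup. [cite: EngelNagel2000, Ch. II §2.1] -/
theorem conj_app (T : C0Semigroup 𝕜 E) (e : E ≃L[𝕜] E') (t : ℝ≥0) :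
    C0Semigroup.app (T.conj e) t = (e : E →L[𝕜] E').comp ((T.app t).comp (e.symm : E' →L[𝕜] E)) := rfl

/-- `(T.conj e)(t) w = e (T(t) (e⁻¹ w))`. [cite: EngelNagel2000, Ch. II §2.1] -/
@[simp]
theorem conj_app_apply (T : C0Semigroup 𝕜 E) (e : E ≃L[𝕜] E') (t : ℝ≥0) (w : E') :
    C0Semigroup.app (T.conj e) t w = e (T.app t (e.symm w)) := rfl

/-- **Isometric conjugation preserves operator-norm bounds**: for a linear isometry
equivalence `e`, `‖(T.conj e)(t)‖ ≤ ‖T(t)‖`; in particular growth bounds `‖T(t)‖ ≤ M e^{ωt}`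
transfer verbatim. [cite: EngelNagel2000, Ch. II §2.1] -/
theorem norm_conj_app_le (T : C0Semigroup 𝕜 E) (e : E ≃ₗᵢ[𝕜] E') (t : ℝ≥0) :
    ‖C0Semigroup.app (T.conj (e.toContinuousLinearEquiv : E ≃L[𝕜] E')) t‖ ≤ ‖T.app t‖ := by
  refine ContinuousLinearMap.opNorm_le_bound _ (norm_nonneg _) fun w => ?_
  rw [conj_app_apply]
  change ‖e (T.app t (e.symm w))‖ ≤ _
  rw [LinearIsometryEquiv.norm_map]
  calc ‖T.app t (e.symm w)‖ ≤ ‖T.app t‖ * ‖e.symm w‖ := (T.app t).le_opNorm _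
    _ = ‖T.app t‖ * ‖w‖ := by rw [LinearIsometryEquiv.norm_map]

/-- Growth bounds transfer along isometric conjugation. [cite: EngelNagel2000, Ch. II §2.1] -/
theorem norm_conj_app_le_of_le (T : C0Semigroup 𝕜 E) (e : E ≃ₗᵢ[𝕜] E') {M ω : ℝ}
    (hM : ∀ t : ℝ≥0, ‖T.app t‖ ≤ M * Real.exp (ω * t)) (t : ℝ≥0) :
    ‖C0Semigroup.app (T.conj (e.toContinuousLinearEquiv : E ≃L[𝕜] E')) t‖ ≤ M * Real.exp (ω * t) :=
  (norm_conj_app_le T e t).trans (hM t)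

end C0Semigroup

end Literature.Analysis.UnboundedOperators
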